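import Mathlib

/-!
# Elementary yardsticks for the extreme-enstrophy-growth farm: the Stokes fixed-energy value, the 2½-D shear identity, the fixed-Ḣ³ interpolation ceiling

Analysis/FluidPDE file, companion of `ExtremeGrowthValueFunction.lean` (the KYP value function
`Φ_T(ℰ₀)`) and `ExtremeGrowthBounds.lean`.  It records, as kernel-checked real analysis, the two
closed-form comparison values against which the optimiser farm's rows are read
(pub-fluidc BOUNDS.md (1.10a) and (1.11a)); no Navier–Stokes object is mentioned — the link to the
flow is stated in the docstrings and is elementary kinematics.

§A  FIXED-ENERGY CELL, STOKES REFERENCE.  Maximising terminal enstrophy `ℰ(T)` at prescribed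
kinetic energy `K₀` (initial enstrophy free): for Stokes flow on the torus every Fourier mode decays
independently, `û_k(T) = û_k(0) e^{-ν|k|²T}`, so with `a_k := |û_k(0)|²` (`Σ a_k = 2K₀`),
`κ_k := |k|²`:  `2ℰ(T) = Σ κ_k a_k e^{-2νTκ_k} ≤ 2K₀/(2eνT)`, i.e. the dimensionless number the farm
reports, `b := 2νTℰ(T)/K₀`, has `b_Stokes ≤ 1/e` (equality in the continuum for one mode at
`|k|² = 1/(2νT)`); `b/b_Stokes - 1` is the nonlinear enhancement.
* `mul_exp_neg_mul_le` — `x e^{-cx} ≤ 1/(ec)` (`c > 0`, all real `x`), sharp at `x = 1/c`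
  (`inv_mul_exp_neg_eq_inv_exp_mul`);
* `sum_mul_mul_exp_neg_le`, `sum_mul_mul_exp_neg_two_nu_T_le` — the finite-sum (Galerkin) Stokes
  bound `Σ κ_i a_i e^{-cκ_i} ≤ (Σ a_i)/(ec)`, `c = 2νT`.

§B  THE KINEMATIC (2½-D SHEAR) FLOOR, EULER CLOSED FORM.  `u(t,x,y,z) = (f(y), 0, g(x - t f(y)))`
is an exact smooth Euler solution on the 3-torus (pressure `0`; Majda–Bertozzi, Vorticity and
Incompressible Flow, §2.3.1 Prop. 2.7–2.8) whose vorticity `ω = (-t f′(y) g′(ξ), -g′(ξ), -f′(y))`,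
`ξ = x - t f(y)`, is tilted by the shear, `|ω|² = t² A(y) B(ξ) + B(ξ) + A(y)` with `A := f′²`,
`B := g′²`.  The integration step is translation invariance in `x`:
* `integral_mul_integral_sub_shift` — `∫ y, F y (∫ x, G (x - φ y)) = (∫F)(∫G)` on the unit circle;
* `shear_enstrophy_integral_decouples` — `∫∫ |ω|² = t²(∫A)(∫B) + ∫B + ∫A` (iterated integrals);
* `shear_enstrophy_closed_form` — the algebra `½(t²ab + b + a) = ℰ₀(1 + 2s(1-s)ℰ₀t²)` with
  `ℰ₀ = ½(a + b)`, `s = a/(a + b)`: enstrophy grows like `t²` without bound and never blows up inside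
  this laminar class, and at fixed `ℰ₀` the Euler finite-time growth is unbounded in `T` already here.
For Navier–Stokes (`ν > 0`) the same class stays exactly linear (`g` becomes a passive scalar in a
decaying Kolmogorov shear) and gives the numerical floor `G_sh(ℰ₀)` of BOUNDS (1.11b) — not
formalised.

§C  THE FIXED-PALINSTROPHY CLASS OPTIMUM (BOUNDS (3.8c), the Euler cell `zp`).  Under a palinstrophy
budget `𝒫(u₀) = ½∫|∇ω₀|² ≤ 𝒫₀` on the box of side `L`, Poincaré (mean-zero periodic profiles) gives
`k₀² · ½(a + b) ≤ 𝒫₀`, `k₀ = 2π/L`, i.e. `a + b ≤ C := 2𝒫₀/k₀²` (analysis, not formalised here).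
What IS formalised is the optimisation over the class at fixed budget:
* `shear_enstrophy_le_of_budget` — for `a, b ≥ 0`, `a + b ≤ C`:
  `½(t²ab + b + a) ≤ (C/2)(1 + (C/2)t²/2)` (AM–GM `ab ≤ (a+b)²/4`);
* `shear_enstrophy_budget_eq` — equality at `a = b = C/2` (equal shares on the gravest shell), so the
  class supremum at fixed palinstrophy is exactly `ℰ_L(t) = ℰ₀ᶜ(1 + ℰ₀ᶜt²/2)`, `ℰ₀ᶜ = C/2 = 𝒫₀/k₀²`
  (`= 253.30(1 + 126.65t²)` at `𝒫₀ = 10⁴`, `L = 1`: `574.1` at `t = 0.1`, `1536.6` at `t = 0.2` — the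
  explicit competitor every optimiser end-point of that cell is measured against; ANALYSIS-OPT F-r).

§D  THE FIXED-Ḣ³ INTERPOLATION CEILING (BOUNDS (3.9a), the Euler cell `zh`: maximise `ℰ(T)` at
prescribed `H₃(u₀) := ½Σ|k|⁶|û_k|²`, the well-posed `H^s`, `s > 5/2`, normalisation).  With shell sums
`A = Σ a_k` (`= 2K`), `B = Σ w_k a_k` (`= 2ℰ`), `C = Σ w_k² a_k`, `D = Σ w_k³ a_k` (`= 2H₃`),
`a_k = |û_k|² ≥ 0`, `w_k = |k|² ≥ 0`, Cauchy–Schwarz twice (`B² ≤ AC`, `C² ≤ BD`) gives `B³ ≤ A²D`,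
i.e. `ℰ³ ≤ K²·H₃` for every field and every truncation (equality iff one shell).  Since (Galerkin-)Euler
conserves `K`, enstrophy growth at fixed data costs `H₃`-growth to the third power:
`ℰ(t) ≤ (K₀² H₃(t))^{1/3}`; with the lattice Poincaré caps `K ≤ H₀/k₀⁶`, `ℰ ≤ H₀/k₀⁴` this is the
yardstick of BOUNDS (3.9) (steady gravest-shell floor `H₀/k₀⁴`, cube-root dictionary to the
fixed-`Ḣ³` value function of Zhao–Protas).
* `sq_sum_mul_le_sum_mul_sum_sq_mul` — weighted Cauchy–Schwarz `(Σ q b)² ≤ (Σ b)(Σ q² b)`, `b ≥ 0`;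
* `sum_mul_pow_three_le_sq_mul_sum` — `(Σ w a)³ ≤ (Σ a)²(Σ w³ a)` for `a, w ≥ 0`.
* `pow_three_mul_sum_le`, `sq_mul_sum_mul_le` — the lattice Poincaré caps at fixed `H₃` (BOUNDS (3.9b)):
  if every weight satisfies `w₀ ≤ w_i` (`w₀ ≥ 0`, the gravest shell `k₀²`), then `w₀³ Σ a ≤ Σ w³ a`
  (`K ≤ H₃/k₀⁶`) and `w₀² Σ w a ≤ Σ w³ a` (`ℰ ≤ H₃/k₀⁴`), with equality iff all the mass sits at `w = w₀`.

Honest framing of the programme these lemmas serve: low prior, high value-of-information experiment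
on Tao's machine paradigm; NOT a claim that NS blows up.
-/

noncomputable section

open Real Finset MeasureTheory

namespace Literature.Analysis.FluidPDE

/-! ### §A Stokes fixed-energy reference -/

/-- `x · e^{-cx} ≤ 1/(e c)` for `c > 0` (all real `x`; for `x ≤ 0` the left side is `≤ 0`).
The maximum of `x ↦ x e^{-cx}` on `ℝ` is attained at `x = 1/c` with value `1/(ec)`; the proof is
the tangent-line inequality `y + 1 ≤ e^y` at `y = cx - 1`. [folklore] -/
theorem mul_exp_neg_mul_le_inv_exp_mul {c : ℝ} (hc : 0 < c) (x : ℝ) :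
    x * exp (-(c * x)) ≤ (exp 1 * c)⁻¹ := by
  have h1 : c * x ≤ exp (c * x - 1) := by
    have := add_one_le_exp (c * x - 1)
    linarith
  have h2 : exp (c * x - 1) = exp (c * x) / exp 1 := by
    rw [Real.exp_sub]
  have he : 0 < exp 1 := exp_pos 1
  have hcx : c * x * exp 1 ≤ exp (c * x) := by
    rw [h2] at h1
    rwa [le_div_iff₀ he] at h1
  have hexp : 0 < exp (-(c * x)) := exp_pos _
  -- multiply through by e^{-cx} / (e c) > 0
  have key : x * exp (-(c * x)) * (exp 1 * c) ≤ 1 := by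
    have : c * x * exp 1 * exp (-(c * x)) ≤ exp (c * x) * exp (-(c * x)) :=
      mul_le_mul_of_nonneg_right hcx hexp.le
    rw [← Real.exp_add, add_neg_cancel, exp_zero] at this
    calc x * exp (-(c * x)) * (exp 1 * c) = c * x * exp 1 * exp (-(c * x)) := by ring
      _ ≤ 1 := this
  have hpos : 0 < exp 1 * c := mul_pos he hc
  rwa [← le_div_iff₀ hpos, div_eq_mul_inv, one_mul] at key

/-- The value `1/(ec)` is attained at `x = 1/c`: the bound `mul_exp_neg_mul_le_inv_exp_mul` is sharp. [folklore] -/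
theorem inv_mul_exp_neg_eq_inv_exp_mul {c : ℝ} (hc : 0 < c) :
    c⁻¹ * exp (-(c * c⁻¹)) = (exp 1 * c)⁻¹ := by
  rw [mul_inv_cancel₀ hc.ne', Real.exp_neg, mul_inv, mul_comm]

/-- FINITE-SUM STOKES BOUND (the fixed-energy yardstick).  For nonnegative modal energies `a i`,
arbitrary `κ i` (squared wavenumbers) and `c > 0` (`c = 2νT`):
`Σ κ_i a_i e^{-c κ_i} ≤ (Σ a_i)/(e c)`.  With `Σ a_i = 2K₀` and the left side `= 2ℰ(T)` for Stokes
flow this is `ℰ(T) ≤ K₀/(2eνT)`, i.e. `b_Stokes := 2νTℰ(T)/K₀ ≤ 1/e`. [folklore] -/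
theorem sum_mul_mul_exp_neg_le {ι : Type*} (s : Finset ι) (κ a : ι → ℝ) {c : ℝ} (hc : 0 < c)
    (ha : ∀ i ∈ s, 0 ≤ a i) :
    ∑ i ∈ s, κ i * a i * exp (-(c * κ i)) ≤ (∑ i ∈ s, a i) / (exp 1 * c) := by
  rw [Finset.sum_div]
  apply Finset.sum_le_sum
  intro i hi
  have h := mul_exp_neg_mul_le_inv_exp_mul hc (κ i)
  calc κ i * a i * exp (-(c * κ i)) = a i * (κ i * exp (-(c * κ i))) := by ring
    _ ≤ a i * (exp 1 * c)⁻¹ := mul_le_mul_of_nonneg_left h (ha i hi)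
    _ = a i / (exp 1 * c) := by rw [div_eq_mul_inv]

/-- The same bound in the farm's normalisation: with `c = 2νT`, `ν, T > 0`,
`Σ κ_i a_i e^{-2νTκ_i} ≤ (Σ a_i) / (2 e ν T)`. [folklore] -/
theorem sum_mul_mul_exp_neg_two_nu_T_le {ι : Type*} (s : Finset ι) (κ a : ι → ℝ) {ν T : ℝ}
    (hν : 0 < ν) (hT : 0 < T) (ha : ∀ i ∈ s, 0 ≤ a i) :
    ∑ i ∈ s, κ i * a i * exp (-(2 * ν * T * κ i)) ≤ (∑ i ∈ s, a i) / (2 * exp 1 * ν * T) := by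
  have hc : 0 < 2 * ν * T := by positivity
  have h := sum_mul_mul_exp_neg_le s κ a hc ha
  have : exp 1 * (2 * ν * T) = 2 * exp 1 * ν * T := by ring
  rwa [this] at h


/-! ### §B The 2½-D shear floor: translation invariance and the Euler closed form -/

/-- Translation invariance packaged for the shear map: for ANY `G` and any `y`-dependent shift `φ y`,
`∫ y, F y · (∫ x, G (x - φ y)) = (∫ F)(∫ G)` on the unit circle (Haar measure; no integrability
hypotheses — both sides take the same junk value otherwise). [folklore] -/
theorem integral_mul_integral_sub_shift (F G : UnitAddCircle → ℝ) (φ : UnitAddCircle → UnitAddCircle) :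
    ∫ y, F y * (∫ x, G (x - φ y)) = (∫ y, F y) * ∫ x, G x := by
  simp_rw [integral_sub_right_eq_self G]
  exact integral_mul_const _ _

/-- THE 2½-D SHEAR EULER ENSTROPHY IDENTITY (iterated-integral form).  For the exact Euler solution
`u(t,x,y,z) = (f(y), 0, g(x - t f(y)))` on the unit 3-torus (pressure `0`; Majda–Bertozzi Prop. 2.7)
the vorticity is `ω = (-t f′(y) g′(ξ), -g′(ξ), -f′(y))` with `ξ = x - t f(y)`, so
`|ω|² = t² A(y) B(ξ) + B(ξ) + A(y)` with `A := f′²`, `B := g′²`.  This lemma is the integration step: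
the iterated integral over the torus DECOUPLES by translation invariance in `x`,
`∫∫ |ω|² = t² (∫A)(∫B) + ∫B + ∫A`, i.e. `ℰ(t) = ℰ₀ (1 + 2s(1-s) ℰ₀ t²)` with `ℰ₀ = ½(∫A + ∫B)`,
`s = ∫A /(∫A + ∫B)` — enstrophy grows without bound but never blows up inside this laminar class.
(The kinematic computation of `ω` is recorded here, not formalised; `A`, `B` are arbitrary integrable
profiles and the shift `t f y` enters through the coercion `ℝ → UnitAddCircle`.)
[cite: MajdaBertozziCUP2002, §2.3.1 Prop. 2.7–2.8 (2½-D flows); the enstrophy identity itself: folklore] -/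
theorem shear_enstrophy_integral_decouples (A B f : UnitAddCircle → ℝ) (t : ℝ)
    (hA : Integrable A) (hB : Integrable B) :
    ∫ y, ∫ x, (t ^ 2 * A y * B (x - ((t * f y : ℝ) : UnitAddCircle)) + B (x - ((t * f y : ℝ) : UnitAddCircle)) + A y)
      = t ^ 2 * (∫ y, A y) * (∫ x, B x) + (∫ x, B x) + ∫ y, A y := by
  haveI : IsProbabilityMeasure (volume : Measure UnitAddCircle) := ⟨UnitAddCircle.measure_univ⟩
  have inner : ∀ y, ∫ x, (t ^ 2 * A y * B (x - ((t * f y : ℝ) : UnitAddCircle)) + B (x - ((t * f y : ℝ) : UnitAddCircle)) + A y)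
      = t ^ 2 * A y * (∫ x, B x) + (∫ x, B x) + A y := by
    intro y
    set c : UnitAddCircle := ((t * f y : ℝ) : UnitAddCircle)
    have hBc : Integrable (fun x => B (x - c)) := hB.comp_sub_right c
    have h1 : Integrable (fun x => t ^ 2 * A y * B (x - c)) := hBc.const_mul _
    have h2 : Integrable (fun x => t ^ 2 * A y * B (x - c) + B (x - c)) := h1.add hBc
    rw [integral_add h2 (integrable_const _), integral_add h1 hBc, integral_const_mul,
      integral_sub_right_eq_self B c]
    simp
  simp_rw [inner]
  have h3 : Integrable (fun y => t ^ 2 * A y * ∫ x, B x) := (hA.const_mul (t ^ 2)).mul_const _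
  have h4 : Integrable (fun y => t ^ 2 * A y * (∫ x, B x) + ∫ x, B x) := h3.add (integrable_const _)
  rw [integral_add h4 hA, integral_add h3 (integrable_const _)]
  have : ∫ y, t ^ 2 * A y * ∫ x, B x = t ^ 2 * (∫ y, A y) * ∫ x, B x := by
    rw [show (fun y => t ^ 2 * A y * ∫ x, B x) = (fun y => (t ^ 2 * ∫ x, B x) * A y) from funext fun y => by ring,
      integral_const_mul]; ring
  rw [this]; simp


/-- The closed form behind BOUNDS (1.11a): with `ℰ₀ := ½(a + b)` (`a = ∫f′²`, `b = ∫g′²`) and shear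
share `s := a/(a + b)`, the decoupled enstrophy `½(t²ab + b + a)` equals `ℰ₀ (1 + 2s(1-s) ℰ₀ t²)`;
for `s = ½` this is `ℰ₀(1 + ℰ₀t²/2)`. [folklore] -/
theorem shear_enstrophy_closed_form (a b t : ℝ) (hab : a + b ≠ 0) :
    (t ^ 2 * a * b + b + a) / 2
      = (a + b) / 2 * (1 + 2 * (a / (a + b)) * (1 - a / (a + b)) * ((a + b) / 2) * t ^ 2) := by
  field_simp
  ring


/-! ### §C The fixed-palinstrophy class optimum (BOUNDS (3.8c)) -/

/-- CLASS OPTIMUM UNDER A BUDGET ON `a + b`.  For nonnegative profile enstrophies `a = ∫f′²`, `b = ∫g′²`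
with `a + b ≤ C` (the form a palinstrophy budget takes after Poincaré, `C = 2𝒫₀/k₀²`), the decoupled
shear enstrophy `½(t²ab + b + a)` of `shear_enstrophy_integral_decouples` is at most
`(C/2)(1 + (C/2)t²/2)`.  Proof: AM–GM `ab ≤ (a+b)²/4 ≤ C²/4` and `a + b ≤ C`. [folklore] -/
theorem shear_enstrophy_le_of_budget (a b t C : ℝ) (ha : 0 ≤ a) (hb : 0 ≤ b) (hC : a + b ≤ C) :
    (t ^ 2 * a * b + b + a) / 2 ≤ C / 2 * (1 + C / 2 * t ^ 2 / 2) := by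
  have hab : a * b ≤ (a + b) ^ 2 / 4 := by nlinarith [sq_nonneg (a - b)]
  have hsum : 0 ≤ a + b := add_nonneg ha hb
  have hsq : (a + b) ^ 2 ≤ C ^ 2 := by
    have := mul_le_mul hC hC hsum (le_trans hsum hC)
    nlinarith [this]
  have ht : 0 ≤ t ^ 2 := sq_nonneg t
  have h1 : t ^ 2 * a * b ≤ t ^ 2 * (C ^ 2 / 4) := by
    have : t ^ 2 * a * b = t ^ 2 * (a * b) := by ring
    rw [this]
    exact mul_le_mul_of_nonneg_left (le_trans hab (by linarith)) ht
  have h2 : C / 2 * (1 + C / 2 * t ^ 2 / 2) = (t ^ 2 * (C ^ 2 / 4) + C) / 2 := by ring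
  rw [h2]
  linarith

/-- The budget bound is ATTAINED at equal shares `a = b = C/2` (both profiles on the gravest shell):
the class supremum of the Euler enstrophy at time `t` under the budget is exactly
`ℰ_L(t) = (C/2)(1 + (C/2)t²/2)`. [folklore] -/
theorem shear_enstrophy_budget_eq (t C : ℝ) :
    (t ^ 2 * (C / 2) * (C / 2) + C / 2 + C / 2) / 2 = C / 2 * (1 + C / 2 * t ^ 2 / 2) := by
  ring


/-! ### §D The fixed-Ḣ³ interpolation ceiling (BOUNDS (3.9a), the Euler cell `zh`) -/

/-- WEIGHTED CAUCHY–SCHWARZ ON SHELL SUMS.  For nonnegative `b i` and arbitrary real `q i`: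
`(Σ q_i b_i)² ≤ (Σ b_i)(Σ q_i² b_i)` — `Finset.sum_mul_sq_le_sq_mul_sq` applied to `√b_i` and
`q_i √b_i`. [folklore] -/
theorem sq_sum_mul_le_sum_mul_sum_sq_mul {ι : Type*} (s : Finset ι) (q b : ι → ℝ)
    (hb : ∀ i ∈ s, 0 ≤ b i) :
    (∑ i ∈ s, q i * b i) ^ 2 ≤ (∑ i ∈ s, b i) * ∑ i ∈ s, q i ^ 2 * b i := by
  have h := Finset.sum_mul_sq_le_sq_mul_sq s (fun i => Real.sqrt (b i))
    (fun i => q i * Real.sqrt (b i))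
  have e1 : ∑ i ∈ s, Real.sqrt (b i) * (q i * Real.sqrt (b i)) = ∑ i ∈ s, q i * b i := by
    refine Finset.sum_congr rfl fun i hi => ?_
    have hs := Real.mul_self_sqrt (hb i hi)
    calc Real.sqrt (b i) * (q i * Real.sqrt (b i))
        = q i * (Real.sqrt (b i) * Real.sqrt (b i)) := by ring
      _ = q i * b i := by rw [hs]
  have e2 : ∑ i ∈ s, Real.sqrt (b i) ^ 2 = ∑ i ∈ s, b i := by
    refine Finset.sum_congr rfl fun i hi => ?_
    exact Real.sq_sqrt (hb i hi)
  have e3 : ∑ i ∈ s, (q i * Real.sqrt (b i)) ^ 2 = ∑ i ∈ s, q i ^ 2 * b i := by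
    refine Finset.sum_congr rfl fun i hi => ?_
    rw [mul_pow, Real.sq_sqrt (hb i hi)]
  rw [e1, e2, e3] at h
  exact h

/-- INTERPOLATION `ℰ³ ≤ K²·H₃` (BOUNDS (3.9a)).  For nonnegative modal energies `a i` and nonnegative
weights `w i` (`w i = |k_i|²`): `(Σ w_i a_i)³ ≤ (Σ a_i)² (Σ w_i³ a_i)`.  Proof: with `A = Σ a`,
`B = Σ w a`, `C = Σ w² a`, `D = Σ w³ a`, the weighted Cauchy–Schwarz gives `B² ≤ AC` (weights `a`)
and `C² ≤ BD` (weights `w a`), hence `B⁴ ≤ A²C² ≤ A²BD`; divide by `B` (the case `B = 0` is trivial).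
Read with `A = 2K`, `B = 2ℰ`, `D = 2H₃`: `ℰ³ ≤ K² H₃`, so along an energy-conserving evolution
`ℰ(t) ≤ (K₀² H₃(t))^{1/3}`. [folklore] -/
theorem sum_mul_pow_three_le_sq_mul_sum {ι : Type*} (s : Finset ι) (w a : ι → ℝ)
    (ha : ∀ i ∈ s, 0 ≤ a i) (hw : ∀ i ∈ s, 0 ≤ w i) :
    (∑ i ∈ s, w i * a i) ^ 3 ≤ (∑ i ∈ s, a i) ^ 2 * ∑ i ∈ s, w i ^ 3 * a i := by
  have hwa : ∀ i ∈ s, 0 ≤ w i * a i := fun i hi => mul_nonneg (hw i hi) (ha i hi)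
  -- B² ≤ A·C
  have h1 : (∑ i ∈ s, w i * a i) ^ 2 ≤ (∑ i ∈ s, a i) * ∑ i ∈ s, w i ^ 2 * a i :=
    sq_sum_mul_le_sum_mul_sum_sq_mul s w a ha
  -- C² ≤ B·D (weights `w a`)
  have h2 : (∑ i ∈ s, w i * (w i * a i)) ^ 2
      ≤ (∑ i ∈ s, w i * a i) * ∑ i ∈ s, w i ^ 2 * (w i * a i) :=
    sq_sum_mul_le_sum_mul_sum_sq_mul s w (fun i => w i * a i) hwa
  have eC : ∑ i ∈ s, w i * (w i * a i) = ∑ i ∈ s, w i ^ 2 * a i :=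
    Finset.sum_congr rfl fun i _ => by ring
  have eD : ∑ i ∈ s, w i ^ 2 * (w i * a i) = ∑ i ∈ s, w i ^ 3 * a i :=
    Finset.sum_congr rfl fun i _ => by ring
  rw [eC, eD] at h2
  have hA : 0 ≤ ∑ i ∈ s, a i := Finset.sum_nonneg ha
  have hB : 0 ≤ ∑ i ∈ s, w i * a i := Finset.sum_nonneg hwa
  have hC : 0 ≤ ∑ i ∈ s, w i ^ 2 * a i :=
    Finset.sum_nonneg fun i hi => mul_nonneg (sq_nonneg _) (ha i hi)
  have hD : 0 ≤ ∑ i ∈ s, w i ^ 3 * a i :=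
    Finset.sum_nonneg fun i hi => mul_nonneg (pow_nonneg (hw i hi) 3) (ha i hi)
  -- abbreviate
  generalize hAe : ∑ i ∈ s, a i = A at *
  generalize hBe : ∑ i ∈ s, w i * a i = B at *
  generalize hCe : ∑ i ∈ s, w i ^ 2 * a i = C at *
  generalize hDe : ∑ i ∈ s, w i ^ 3 * a i = D at *
  have h4 : B ^ 4 ≤ A ^ 2 * B * D := by
    calc B ^ 4 = (B ^ 2) ^ 2 := by ring
      _ ≤ (A * C) ^ 2 := pow_le_pow_left₀ (sq_nonneg _) h1 2
      _ = A ^ 2 * C ^ 2 := by ring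
      _ ≤ A ^ 2 * (B * D) := mul_le_mul_of_nonneg_left h2 (sq_nonneg _)
      _ = A ^ 2 * B * D := by ring
  rcases eq_or_lt_of_le hB with hB0 | hBpos
  · rw [← hB0]
    have : (0 : ℝ) ^ 3 = 0 := by norm_num
    rw [this]
    positivity
  · have h5 : B * B ^ 3 ≤ B * (A ^ 2 * D) := by nlinarith [h4]
    exact le_of_mul_le_mul_left h5 hBpos


/-- LATTICE POINCARÉ CAP ON THE ENERGY AT FIXED `H₃` (BOUNDS (3.9b)).  If `0 ≤ w₀ ≤ w i` on the support
and `a i ≥ 0`, then `w₀³ Σ a_i ≤ Σ w_i³ a_i`; with `w₀ = k₀²`, `A = 2K`, `D = 2H₃`: `K ≤ H₃/k₀⁶`. [folklore] -/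
theorem pow_three_mul_sum_le {ι : Type*} (s : Finset ι) (w a : ι → ℝ) {w₀ : ℝ} (hw₀ : 0 ≤ w₀)
    (hw : ∀ i ∈ s, w₀ ≤ w i) (ha : ∀ i ∈ s, 0 ≤ a i) :
    w₀ ^ 3 * ∑ i ∈ s, a i ≤ ∑ i ∈ s, w i ^ 3 * a i := by
  rw [Finset.mul_sum]
  apply Finset.sum_le_sum
  intro i hi
  exact mul_le_mul_of_nonneg_right (pow_le_pow_left₀ hw₀ (hw i hi) 3) (ha i hi)

/-- LATTICE POINCARÉ CAP ON THE ENSTROPHY AT FIXED `H₃` (BOUNDS (3.9b)).  If `0 ≤ w₀ ≤ w i` on the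
support and `a i ≥ 0`, then `w₀² Σ w_i a_i ≤ Σ w_i³ a_i`; with `w₀ = k₀²`, `B = 2ℰ`, `D = 2H₃`:
`ℰ ≤ H₃/k₀⁴` — attained by any field living on the gravest shell (the steady ABC / Kolmogorov floor of
BOUNDS (3.9c) sits exactly at this cap). [folklore] -/
theorem sq_mul_sum_mul_le {ι : Type*} (s : Finset ι) (w a : ι → ℝ) {w₀ : ℝ} (hw₀ : 0 ≤ w₀)
    (hw : ∀ i ∈ s, w₀ ≤ w i) (ha : ∀ i ∈ s, 0 ≤ a i) :
    w₀ ^ 2 * ∑ i ∈ s, w i * a i ≤ ∑ i ∈ s, w i ^ 3 * a i := by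
  rw [Finset.mul_sum]
  apply Finset.sum_le_sum
  intro i hi
  have hwi : 0 ≤ w i := le_trans hw₀ (hw i hi)
  have h2 : w₀ ^ 2 ≤ w i ^ 2 := pow_le_pow_left₀ hw₀ (hw i hi) 2
  calc w₀ ^ 2 * (w i * a i) = w₀ ^ 2 * w i * a i := by ring
    _ ≤ w i ^ 2 * w i * a i :=
        mul_le_mul_of_nonneg_right (mul_le_mul_of_nonneg_right h2 hwi) (ha i hi)
    _ = w i ^ 3 * a i := by ring

end Literature.Analysis.FluidPDE

end
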